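import Literature.Geometry.Lorentzian.CarterHorizonPocket
import Literature.Geometry.Lorentzian.TeukolskyRadialHeunForm
import Literature.Geometry.Lorentzian.TeukolskyHorizonNormalisedLimits
import HarnessLib

/-!
# The `κ`-free horizon pocket for `|ξ| ≤ 1`, part 1: the blown-up coefficient and the collar calculus
(namespace `Literature.Geometry.Lorentzian.Kerr`.)

Scalar radial Teukolsky equation on sub-extremal Kerr (Teixeira da Costa 2020, Def. 2.3; used by
the crux `KappaExplicitWaveDecay`, stub `stub_horizonSupBoxPoly`). Notation:
`d = r₊ − r₋`, `σ = ω − mω₊`, `ξ = (2Mr₊/d)σ = σ/(2κ)` (so that Teixeira da Costa's horizon exponent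
is `ξ_TdC = −iξ`, `Kerr.horizonExponent`), `x = (r − r₊)/d` the blown-up radius,
`W(x) = √(x(x+1)) R(r₊ + dx)`, and `Q` the coefficient of the Liouville normal form `W″ = Q W` of
the scalar radial Teukolsky ODE (Teukolsky–Press 1974 §II; in the tree the equivalence with the
radial ODE is the Summits-side `stub_olverNormalForm`, so here the normal form enters as a HYPOTHESIS):
`Q = ((Λ − 2amω)x(x+1) − k² − ¼)/(x(x+1))²`, `k = K(r₊ + dx)/d = ξ + ωx(2r₊ + dx)`
(`radialK_blowup_div`).

The point `x = 0` is a regular singular point with exponents `ν = ½ − iξ` and `ν̄`: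
`x²Q = ν(ν − 1) + g`, `ν(ν − 1) = −ξ² − ¼`, and for `|ξ| ≤ 1`, `0 < x ≤ 1`,
`|g(x)| = |x²Q(x) + ξ² + ¼| ≤ C_g x` with the BOUNDED-FREQUENCY constant
`C_g = 4Λ + 6M|ω|(2 + 6M|ω|) + 15/4` (`blowup_pocket_coeff_abs_le`; no `κ` enters). The generic energy
bound at such a point (`Literature.Analysis.ODE.regularSingularEnergy_le_of_tendsto`, energy
`E = ‖W‖²/x + ‖xW′ − νW‖²/x²`, `E′ ≤ (1 + C_g)²E`) is applied in part 2 (`TeukolskyBlowupPocket.lean`). This part records the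
POINTWISE ingredients: `Re ν = ½`, `ν(ν − 1) = −ξ² − ¼` (`nu_re`, `blowup_nu_mul_nu_sub_one`), the identity
`k = ξ + ωx(2r₊ + dx)` (`radialK_blowup_div`), the remainder bound `blowup_pocket_coeff_abs_le`, and the
calculus of the collar representation `W = √(x(x+1))·f(r₊ + dx)·(dx)^{ξ_TdC}` of a solution
normalised at `𝓗⁺` (`hasDerivAt_blowup_collar`, and the algebra `blowup_collar_xWsub_eq`:
`xW′ − νW = (dx)^{ξ_TdC}·(x²/(2√(x(x+1)))·f + x√(x(x+1))·d·f′)` — the `ξ`-terms cancel).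
No named fact is used.

## References
* R. Teixeira da Costa, CMP 378 (2020) 705–781 = arXiv:1910.02854, §2.2.1 (`ξ`), Def. 2.3. [Costa2019]
* S. A. Teukolsky, W. H. Press, Astrophys. J. 193 (1974) 443–461, §II (the variable `x`).
-/

noncomputable section

namespace Literature.Geometry.Lorentzian

namespace Kerr

open Literature.Analysis.ODE
open Filter Set Complex
open scoped _root_.Topology ComplexConjugate

/-! ### The exponent `ν = ½ + ξ_TdC = ½ − iξ` -/

/-- `Re(½ + ξ_TdC) = ½` (the horizon exponent is purely imaginary). [cite: Costa2019, §2.2.1] -/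
theorem blowup_nu_re (M a ω m : ℝ) : ((1 / 2 : ℂ) + horizonExponent M a ω m).re = 1 / 2 := by
  rw [Complex.add_re, Costa2019.horizonExponent_re, add_zero]
  norm_num

/-- `ν(ν − 1) = −ξ² − ¼` for `ν = ½ + ξ_TdC`, `ξ_TdC = −iξ`, `ξ = (2Mr₊/(r₊ − r₋))(ω − mω₊)` real.
[cite: Costa2019, §2.2.1] -/
theorem blowup_nu_mul_nu_sub_one (M a ω m : ℝ) :
    ((1 / 2 : ℂ) + horizonExponent M a ω m) *
        ((1 / 2 : ℂ) + horizonExponent M a ω m - 1) =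
      ((-(2 * M * rPlus M a / (rPlus M a - rMinus M a) *
            (ω - m * horizonAngularVelocity M a)) ^ 2 - 1 / 4 : ℝ) : ℂ) := by
  unfold horizonExponent
  generalize (2 * M * rPlus M a / (rPlus M a - rMinus M a) *
    (ω - m * horizonAngularVelocity M a) : ℝ) = t
  push_cast
  linear_combination (t : ℂ) ^ 2 * Complex.I_mul_I

/-- `‖ξ_TdC + c‖`-free bookkeeping: `‖½ + ξ_TdC‖ ≤ ½ + |ξ|`. [folklore] -/
theorem norm_blowup_nu_le (M a ω m : ℝ) :
    ‖(1 / 2 : ℂ) + horizonExponent M a ω m‖ ≤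
      1 / 2 + |2 * M * rPlus M a / (rPlus M a - rMinus M a) *
        (ω - m * horizonAngularVelocity M a)| := by
  unfold horizonExponent
  generalize (2 * M * rPlus M a / (rPlus M a - rMinus M a) *
    (ω - m * horizonAngularVelocity M a) : ℝ) = t
  calc ‖(1 / 2 : ℂ) + -I * (t : ℂ)‖ ≤ ‖(1 / 2 : ℂ)‖ + ‖-I * (t : ℂ)‖ := norm_add_le _ _
    _ = 1 / 2 + |t| := by
        rw [norm_mul, norm_neg, Complex.norm_I, one_mul, Complex.norm_real, Real.norm_eq_abs]
        norm_num

/-! ### `K/d` along the blown-up radius: `k = ξ + ωx(2r₊ + dx)` -/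

/-- `K(r₊ + dx)/d = ξ + ωx(2r₊ + dx)` with `d = r₊ − r₋`, `ξ = (2Mr₊/d)(ω − mω₊)`
(`K(r) = (r₊² + a²)σ + ω(r − r₊)(r + r₊)`, `r₊² + a² = 2Mr₊`). [folklore] -/
theorem radialK_blowup_div {M a : ℝ} (hM : 0 < M) (ha : |a| < M) (ω : ℝ) (m : ℤ) (x : ℝ) :
    radialK a ω m (rPlus M a + (rPlus M a - rMinus M a) * x) /
        (rPlus M a - rMinus M a) =
      2 * M * rPlus M a / (rPlus M a - rMinus M a) *
          (ω - m * horizonAngularVelocity M a) +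
        ω * x * (2 * rPlus M a + (rPlus M a - rMinus M a) * x) := by
  have hd : rPlus M a - rMinus M a ≠ 0 :=
    (sub_pos.2 (IsSubextremal.rMinus_lt_rPlus ha)).ne'
  rw [radialK_eq_horizon_add hM ha.le, rPlus_sq_add_sq ha.le]
  field_simp
  ring

/-! ### The regular-singular remainder `g = x²Q + ξ² + ¼` is `O(x)` with a `κ`-free constant -/

/-- **`|x²Q(x) + ξ² + ¼| ≤ C_g·x` on `0 < x ≤ 1` for `|ξ| ≤ 1`**, with
`C_g = 4Λ + 6M|ω|(2 + 6M|ω|) + 15/4`: writing `k = ξ + e`, `e = ωx(2r₊ + dx)` (`|e| ≤ 6M|ω|x` as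
`r₊ ≤ 2M`, `d ≤ 2M`, `x ≤ 1`),
`x²Q + ξ² + ¼ = ((Λ − 2amω)x(x+1) − e(2ξ + e) + (ξ² + ¼)(x² + 2x))/(x + 1)²`, and `|Λ − 2amω| ≤ 2Λ`
for an admissible triple. [folklore] -/
theorem blowup_pocket_coeff_abs_le {M a ω Λ : ℝ} {m : ℤ} (hM : 0 < M) (ha : |a| < M)
    (hadm : IsAdmissibleTriple a ω m Λ)
    (hξ : |2 * M * rPlus M a / (rPlus M a - rMinus M a) *
        (ω - m * horizonAngularVelocity M a)| ≤ 1)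
    {x : ℝ} (hx0 : 0 < x) (hx1 : x ≤ 1) :
    |x ^ 2 * (((Λ - 2 * a * m * ω) * (x * (x + 1)) -
            (radialK a ω m (rPlus M a + (rPlus M a - rMinus M a) * x) /
                (rPlus M a - rMinus M a)) ^ 2 - 1 / 4) /
          (x * (x + 1)) ^ 2) +
        ((2 * M * rPlus M a / (rPlus M a - rMinus M a) *
            (ω - m * horizonAngularVelocity M a)) ^ 2 + 1 / 4)| ≤
      (4 * Λ + 6 * M * |ω| * (2 + 6 * M * |ω|) + 15 / 4) * x := by
  set d := rPlus M a - rMinus M a with hd_def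
  set ξ := 2 * M * rPlus M a / d * (ω - m * horizonAngularVelocity M a) with hξ_def
  have hd : 0 < d := sub_pos.2 (IsSubextremal.rMinus_lt_rPlus ha)
  have hd2 : d ≤ 2 * M := by
    rw [hd_def, rPlus_sub_rMinus]
    have : Real.sqrt (M ^ 2 - a ^ 2) ≤ Real.sqrt (M ^ 2) :=
      Real.sqrt_le_sqrt (by nlinarith [sq_nonneg a])
    rw [Real.sqrt_sq hM.le] at this
    linarith
  have hr2 : rPlus M a ≤ 2 * M := rPlus_le_two_mul_self hM.le a
  have hrp : 0 < rPlus M a := rPlus_pos hM a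
  -- `k = ξ + e`
  set e := ω * x * (2 * rPlus M a + d * x) with he_def
  have hk : radialK a ω m (rPlus M a + d * x) / d = ξ + e :=
    radialK_blowup_div hM ha ω m x
  have he : |e| ≤ 6 * M * |ω| * x := by
    rw [he_def, abs_mul, abs_mul, abs_of_pos hx0,
      abs_of_pos (by positivity : 0 < 2 * rPlus M a + d * x)]
    have h1 : 2 * rPlus M a + d * x ≤ 6 * M := by nlinarith
    calc |ω| * x * (2 * rPlus M a + d * x) ≤ |ω| * x * (6 * M) := by gcongr
      _ = 6 * M * |ω| * x := by ring
  -- `|Λ − 2amω| ≤ 2Λ`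
  have hΛ' : |Λ - 2 * a * m * ω| ≤ 2 * Λ := by
    have h2 := hadm.2
    have hΛ0 := hadm.nonneg
    have : |2 * a * m * ω| = 2 * |a * m * ω| := by
      rw [show 2 * a * (m : ℝ) * ω = 2 * (a * m * ω) by ring, abs_mul, abs_two]
    calc |Λ - 2 * a * m * ω| ≤ |Λ| + |2 * a * m * ω| := abs_sub _ _
      _ ≤ Λ + Λ := by rw [abs_of_nonneg hΛ0, this]; linarith
      _ = 2 * Λ := by ring
  -- the algebraic form of `g`
  have hx1' : 0 < x + 1 := by linarith
  have hg : x ^ 2 * (((Λ - 2 * a * m * ω) * (x * (x + 1)) - (ξ + e) ^ 2 - 1 / 4) /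
        (x * (x + 1)) ^ 2) + (ξ ^ 2 + 1 / 4) =
      ((Λ - 2 * a * m * ω) * (x * (x + 1)) - e * (2 * ξ + e) + (ξ ^ 2 + 1 / 4) * (x ^ 2 + 2 * x)) /
        (x + 1) ^ 2 := by
    field_simp
    ring
  rw [hk, hg, abs_div, abs_of_pos (by positivity : 0 < (x + 1) ^ 2), div_le_iff₀ (by positivity)]
  -- bound the numerator by `C_g x ≤ C_g x (x + 1)²`
  have hξ1 : |ξ| ≤ 1 := hξ
  have hξ2 : ξ ^ 2 ≤ 1 := by nlinarith [abs_nonneg ξ, sq_abs ξ]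
  have hN : |(Λ - 2 * a * m * ω) * (x * (x + 1)) - e * (2 * ξ + e) +
      (ξ ^ 2 + 1 / 4) * (x ^ 2 + 2 * x)| ≤
      (4 * Λ + 6 * M * |ω| * (2 + 6 * M * |ω|) + 15 / 4) * x := by
    have h1 : |(Λ - 2 * a * m * ω) * (x * (x + 1))| ≤ 4 * Λ * x := by
      rw [abs_mul, abs_of_pos (by positivity : 0 < x * (x + 1))]
      calc |Λ - 2 * a * m * ω| * (x * (x + 1)) ≤ 2 * Λ * (x * 2) := by
            apply mul_le_mul hΛ' (by nlinarith) (by positivity) (by linarith [hadm.nonneg])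
        _ = 4 * Λ * x := by ring
    have h2 : |e * (2 * ξ + e)| ≤ 6 * M * |ω| * (2 + 6 * M * |ω|) * x := by
      rw [abs_mul]
      have h3 : |2 * ξ + e| ≤ 2 + 6 * M * |ω| := by
        calc |2 * ξ + e| ≤ |2 * ξ| + |e| := abs_add_le _ _
          _ ≤ 2 * 1 + 6 * M * |ω| * x := by rw [abs_mul, abs_two]; gcongr
          _ ≤ 2 + 6 * M * |ω| := by
              have : 6 * M * |ω| * x ≤ 6 * M * |ω| * 1 := by gcongr
              linarith
      calc |e| * |2 * ξ + e| ≤ (6 * M * |ω| * x) * (2 + 6 * M * |ω|) :=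
            mul_le_mul he h3 (abs_nonneg _) (by positivity)
        _ = 6 * M * |ω| * (2 + 6 * M * |ω|) * x := by ring
    have h3 : |(ξ ^ 2 + 1 / 4) * (x ^ 2 + 2 * x)| ≤ 15 / 4 * x := by
      rw [abs_of_nonneg (by positivity)]
      nlinarith
    calc _ ≤ |(Λ - 2 * a * m * ω) * (x * (x + 1)) - e * (2 * ξ + e)| +
          |(ξ ^ 2 + 1 / 4) * (x ^ 2 + 2 * x)| := abs_add_le _ _
      _ ≤ |(Λ - 2 * a * m * ω) * (x * (x + 1))| + |e * (2 * ξ + e)| +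
          |(ξ ^ 2 + 1 / 4) * (x ^ 2 + 2 * x)| := by linarith [abs_sub ((Λ - 2 * a * m * ω) * (x * (x + 1))) (e * (2 * ξ + e))]
      _ ≤ _ := by linarith
  have hC : 0 ≤ (4 * Λ + 6 * M * |ω| * (2 + 6 * M * |ω|) + 15 / 4) * x := by
    have := hadm.nonneg
    positivity
  calc _ ≤ (4 * Λ + 6 * M * |ω| * (2 + 6 * M * |ω|) + 15 / 4) * x := hN
    _ = (4 * Λ + 6 * M * |ω| * (2 + 6 * M * |ω|) + 15 / 4) * x * 1 := (mul_one _).symm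
    _ ≤ (4 * Λ + 6 * M * |ω| * (2 + 6 * M * |ω|) + 15 / 4) * x * (x + 1) ^ 2 := by
        apply mul_le_mul_of_nonneg_left _ hC
        nlinarith

/-! ### Calculus on the collar: `W = √(x(x+1))·f(r₊ + dx)·(dx)^{ξ_TdC}` -/

/-- `d/dy √(y(y+1)) = (2y + 1)/(2√(y(y+1)))` at `y > 0`. [folklore] -/
theorem hasDerivAt_sqrt_mul_add_one {y : ℝ} (hy : 0 < y) :
    HasDerivAt (fun y : ℝ ↦ √(y * (y + 1))) ((2 * y + 1) / (2 * √(y * (y + 1)))) y := by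
  have hP : HasDerivAt (fun y : ℝ ↦ y * (y + 1)) (2 * y + 1) y :=
    ((hasDerivAt_id' y).fun_mul ((hasDerivAt_id' y).add_const 1)).congr_deriv (by ring)
  exact hP.sqrt (by positivity)

/-- **Derivative of the collar representation.** For `f` with derivative `f′` at `r = r_p + dy`
(`d > 0`, `y > 0`) and any complex `p`, the function `z ↦ √(z(z+1))·(f(r_p + dz)·((r_p + dz) − r_p)^p)`
has derivative `S′·(f·T) + S·((d f′)·T + f·(T·(p/(r − r_p))·d))` at `y`
(`S = √(y(y+1))`, `S′ = (2y+1)/(2S)`, `T = (r − r_p)^p`). [folklore] -/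
theorem hasDerivAt_blowup_collar {f : ℝ → ℂ} {f' : ℂ} (p : ℂ) {rp d y : ℝ} (hd : 0 < d) (hy : 0 < y)
    (hf : HasDerivAt f f' (rp + d * y)) :
    HasDerivAt (fun z : ℝ ↦ ((√(z * (z + 1)) : ℝ) : ℂ) *
        (f (rp + d * z) * (((rp + d * z - rp : ℝ) : ℂ)) ^ p))
      ((((2 * y + 1) / (2 * √(y * (y + 1))) : ℝ) : ℂ) *
          (f (rp + d * y) * (((rp + d * y - rp : ℝ) : ℂ)) ^ p) +
        ((√(y * (y + 1)) : ℝ) : ℂ) *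
          ((d : ℂ) * f' * (((rp + d * y - rp : ℝ) : ℂ)) ^ p +
            f (rp + d * y) *
              ((((rp + d * y - rp : ℝ) : ℂ)) ^ p * (p / (((rp + d * y - rp : ℝ) : ℂ))) * d))) y := by
  have hθ : HasDerivAt (fun z : ℝ ↦ rp + d * z) d y := by
    simpa using ((hasDerivAt_id' y).const_mul d).const_add rp
  have hr : rp < rp + d * y := lt_add_of_pos_right _ (mul_pos hd hy)
  have hF : HasDerivAt (fun z : ℝ ↦ f (rp + d * z)) ((d : ℂ) * f') y := by
    simpa [Function.comp_def, Complex.real_smul] using hf.scomp y hθ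
  have hT : HasDerivAt (fun z : ℝ ↦ (((rp + d * z - rp : ℝ) : ℂ)) ^ p)
      ((((rp + d * y - rp : ℝ) : ℂ)) ^ p * (p / (((rp + d * y - rp : ℝ) : ℂ))) * d) y := by
    have h := (Costa2019.hasDerivAt_ofReal_sub_cpow rp p hr).scomp y hθ
    simpa [Function.comp_def, Complex.real_smul, mul_comm] using h
  exact (hasDerivAt_sqrt_mul_add_one hy).ofReal_comp.mul (hF.mul hT)

/-- The algebra of `xW′ − νW` on the collar: with `S² = y(y+1)`, `S ≠ 0`, `D = dy ≠ 0` and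
`ν = ½ + p` (`y, d ≠ 0`), `y·(S′fT + S(d f′ T + f T (p/D) d)) − ν S f T = T·(y²/(2S)·f + ySd·f′)`
(`S′ = (2y+1)/(2S)`; the `p`-terms cancel). [folklore] -/
theorem blowup_collar_xWsub_eq {S S' y d : ℝ} {f₀ f' T p D : ℂ} (hS : S ≠ 0) (hS2 : S ^ 2 = y * (y + 1))
    (hS' : S' = (2 * y + 1) / (2 * S)) (hD : D = ((d * y : ℝ) : ℂ)) (hy : y ≠ 0) (hd : d ≠ 0) :
    (y : ℂ) * ((S' : ℂ) * (f₀ * T) + (S : ℂ) * ((d : ℂ) * f' * T + f₀ * (T * (p / D) * d))) -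
        ((1 / 2 : ℂ) + p) * ((S : ℂ) * (f₀ * T)) =
      T * (((y ^ 2 / (2 * S) : ℝ) : ℂ) * f₀ + ((y * S * d : ℝ) : ℂ) * f') := by
  have hSC : (S : ℂ) ≠ 0 := by exact_mod_cast hS
  have hyC : (y : ℂ) ≠ 0 := by exact_mod_cast hy
  have hdC : (d : ℂ) ≠ 0 := by exact_mod_cast hd
  have hS2C : (S : ℂ) ^ 2 = (y : ℂ) * ((y : ℂ) + 1) := by exact_mod_cast hS2
  rw [hS', hD]
  push_cast
  field_simp
  linear_combination (-(T * f₀)) * hS2C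

/-! ### Inverting the weight of Def. 2.3 -/

/-- Inverting the weight of Def. 2.3 (`s = 0`): `R·t^{0 − ξ} = f` with `t > 0` gives `R = f·t^ξ`.
[cite: Costa2019, Definition 2.3] -/
-- adapted from Literature/Geometry/Lorentzian/TeukolskyHorizonNormalisedLimits.lean
theorem eq_mul_cpow_of_mul_cpow_sub_eq {Ry fy ξ : ℂ} {t : ℝ} (ht : 0 < t)
    (h : Ry * ((t : ℝ) : ℂ) ^ (((0 : ℝ) : ℂ) - ξ) = fy) : Ry = fy * ((t : ℝ) : ℂ) ^ ξ := by
  have hT : ((t : ℝ) : ℂ) ≠ 0 := by exact_mod_cast ht.ne'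
  have hPne : ((t : ℝ) : ℂ) ^ ξ ≠ 0 := fun h0 ↦ hT (Complex.cpow_eq_zero_iff _ _ |>.1 h0).1
  rw [Complex.ofReal_zero, zero_sub, Complex.cpow_neg] at h
  rw [← h, mul_assoc, inv_mul_cancel₀ hPne, mul_one]

end Kerr

end Literature.Geometry.Lorentzian

end
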